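import Summits.Ventures.CertifiedManyBodySolver.Theorems.M3x2EdgeSplitSymReplayBoxCanon
import HarnessLib

/-!
# SymReplay OUTROUTE — additivity of the coarse output key `netKey` on mode-disjoint words (the E2 engine lemma)

(pen hub-lb-sym-plan-1 g3, 2026-08-28; ADDITIVE; restates §(d) of the OUTROUTE module verbatim (same names, namespace
`…SymReplay.NetKeyAdd` to avoid clashes until `…OutRoute` is in the tree) and proves the one algebraic fact the output-sensitive
skeleton E2 of `ENGINE-NOTES.md` rests on.)

E2 reads the slot of a raw product term `u† ++ w` off PRECOMPUTED per-word keys: when the adjoint row word `u†` and the column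
word `w` share no mode `(x, s)`, `netKey (u† ++ w) = netKey u† + netKey w` (`netKey_append`), so the pair's slot is
`(kU + kW) % J` with no letter arithmetic in the inner loop, and pairs of other slots are SKIPPED without building the product;
overlapping pairs (a shared mode: contractions possible) are keyed directly.  Soundness of OUTROUTE never needed this (any key is
sound); the engine's permutation lemma `shareRFast K J i ~ shareR K netKey J i` does, at exactly this point.

CONTENTS: `modeOf`, `keyOf`; `netTableFrom_cons`; `netAdd_append_of_not_mem` (an update of a mode absent from a prefix table passes the prefix);
`keys_netAdd_subset`, `keys_foldl_subset` (table keys ⊆ initial keys ∪ word modes); `foldl_netAdd_append` (a word disjoint from a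
prefix table leaves it in front); `netTable_append`, `netModes_append`, `netKey_append` (additivity); kernel demos.
HONEST FRAMING: list algebra for an engine; no certificate replayed; no bound of record moves; no summit or crux statement is
proved; nothing here predicts superconductivity.
-/

namespace Summit.Ventures.CertifiedManyBodySolver.Theorems.SymReplay.NetKeyAdd

open Summit.Ventures.CertifiedManyBodySolver.Theorems.SymReplay

/-! ##### The key definitions (verbatim §(d) of OUTROUTE) -/

/-- Net mode table update: add `d` to the entry of mode `(x0, x1, s)`, appending a new entry if absent. -/
def netAdd (x0 x1 : ℤ) (s : ℕ) (d : ℤ) : List (ℤ × ℤ × ℕ × ℤ) → List (ℤ × ℤ × ℕ × ℤ)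
  | [] => [(x0, x1, s, d)]
  | e :: tb => if e.1 = x0 ∧ e.2.1 = x1 ∧ e.2.2.1 = s then (x0, x1, s, e.2.2.2 + d) :: tb else e :: netAdd x0 x1 s d tb

/-- The raw net table of a word (zero-net entries kept), from an initial table — the `foldl` inside OUTROUTE's `netModes`. -/
def netTableFrom (tb : List (ℤ × ℤ × ℕ × ℤ)) (w : Word) : List (ℤ × ℤ × ℕ × ℤ) :=
  w.foldl (fun tb ℓ => netAdd (ℓ.x 0) (ℓ.x 1) ℓ.s.val (if ℓ.dag then 1 else -1) tb) tb

/-- The net mode table (zero-net modes dropped). -/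
def netModes (w : Word) : List (ℤ × ℤ × ℕ × ℤ) := (netTableFrom [] w).filter fun e => !decide (e.2.2.2 = 0)

/-- Code of one net mode (position-free): spin and net occupation change. -/
def modeCode (e : ℤ × ℤ × ℕ × ℤ) : ℕ := 1 + 2 * e.2.2.1 + 5 * (e.2.2.2 + 4).toNat

/-- **Coarse key**: the multiset of net modes, positions forgotten. -/
def netKey (w : Word) : ℕ := ((netModes w).map modeCode).sum

/-! ##### Modes and keys -/

/-- The mode `(x 0, x 1, spin)` of a letter. -/
def modeOf (l : Letter) : ℤ × ℤ × ℕ := (l.x 0, l.x 1, l.s.val)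

/-- The mode of a table entry. -/
def keyOf (e : ℤ × ℤ × ℕ × ℤ) : ℤ × ℤ × ℕ := (e.1, e.2.1, e.2.2.1)

/-- One fold step. -/
theorem netTableFrom_cons (tb : List (ℤ × ℤ × ℕ × ℤ)) (l : Letter) (w : Word) :
    netTableFrom tb (l :: w) = netTableFrom (netAdd (l.x 0) (l.x 1) l.s.val (if l.dag then 1 else -1) tb) w := rfl

/-- `modeOf` unfolded. -/
theorem modeOf_eq (l : Letter) : modeOf l = (l.x 0, l.x 1, l.s.val) := rfl

/-- An update of a mode ABSENT from a prefix table passes the prefix unchanged. -/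
theorem netAdd_append_of_not_mem (x0 x1 : ℤ) (s : ℕ) (d : ℤ) :
    ∀ (T S : List (ℤ × ℤ × ℕ × ℤ)), (x0, x1, s) ∉ T.map keyOf → netAdd x0 x1 s d (T ++ S) = T ++ netAdd x0 x1 s d S
  | [], _, _ => rfl
  | e :: T, S, h => by
    rw [List.map_cons, List.mem_cons, not_or] at h
    have hne : ¬ (e.1 = x0 ∧ e.2.1 = x1 ∧ e.2.2.1 = s) := by
      rintro ⟨h1, h2, h3⟩
      exact h.1 (by simp [keyOf, h1, h2, h3])
    rw [List.cons_append, netAdd, if_neg hne, netAdd_append_of_not_mem x0 x1 s d T S h.2, List.cons_append]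

/-- The keys of an updated table are among the old keys and the updated mode. -/
theorem keys_netAdd_subset (x0 x1 : ℤ) (s : ℕ) (d : ℤ) :
    ∀ (T : List (ℤ × ℤ × ℕ × ℤ)) (k : ℤ × ℤ × ℕ), k ∈ (netAdd x0 x1 s d T).map keyOf → k ∈ T.map keyOf ∨ k = (x0, x1, s)
  | [], k, h => by
    rw [netAdd, List.map_singleton, List.mem_singleton] at h
    exact Or.inr h
  | e :: T, k, h => by
    rw [netAdd] at h
    split_ifs at h with hc
    · rw [List.map_cons, List.mem_cons] at h
      rcases h with h | h
      · exact Or.inr h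
      · exact Or.inl (by rw [List.map_cons, List.mem_cons]; exact Or.inr h)
    · rw [List.map_cons, List.mem_cons] at h
      rcases h with h | h
      · exact Or.inl (by rw [List.map_cons, List.mem_cons]; exact Or.inl h)
      · rcases keys_netAdd_subset x0 x1 s d T k h with h' | h'
        · exact Or.inl (by rw [List.map_cons, List.mem_cons]; exact Or.inr h')
        · exact Or.inr h'

/-- The keys of the table of a word from `tb` are among the keys of `tb` and the modes of the word. -/
theorem keys_foldl_subset :
    ∀ (w : Word) (tb : List (ℤ × ℤ × ℕ × ℤ)) (k : ℤ × ℤ × ℕ),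
      k ∈ (netTableFrom tb w).map keyOf → k ∈ tb.map keyOf ∨ k ∈ w.map modeOf
  | [], _, _, h => Or.inl h
  | l :: w, tb, k, h => by
    rw [netTableFrom_cons] at h
    rcases keys_foldl_subset w _ k h with h' | h'
    · rcases keys_netAdd_subset (l.x 0) (l.x 1) l.s.val _ tb k h' with h'' | h''
      · exact Or.inl h''
      · exact Or.inr (by rw [List.map_cons, List.mem_cons, modeOf_eq]; exact Or.inl h'')
    · exact Or.inr (by rw [List.map_cons, List.mem_cons]; exact Or.inr h')

/-- A word none of whose modes is a key of the prefix table `T` builds its table behind `T`. -/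
theorem foldl_netAdd_append :
    ∀ (w : Word) (T S : List (ℤ × ℤ × ℕ × ℤ)), (∀ l ∈ w, modeOf l ∉ T.map keyOf) →
      netTableFrom (T ++ S) w = T ++ netTableFrom S w
  | [], _, _, _ => rfl
  | l :: w, T, S, h => by
    have hl : (l.x 0, l.x 1, l.s.val) ∉ T.map keyOf := h l (by simp)
    rw [netTableFrom_cons, netTableFrom_cons, netAdd_append_of_not_mem _ _ _ _ T S hl]
    exact foldl_netAdd_append w T _ fun l' hl' => h l' (List.mem_cons_of_mem _ hl')

/-- **Raw tables concatenate on mode-disjoint words.** -/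
theorem netTable_append (u w : Word) (h : ∀ l ∈ w, modeOf l ∉ u.map modeOf) :
    netTableFrom [] (u ++ w) = netTableFrom [] u ++ netTableFrom [] w := by
  rw [netTableFrom, List.foldl_append]
  change netTableFrom (netTableFrom [] u) w = _
  have h' : ∀ l ∈ w, modeOf l ∉ (netTableFrom [] u).map keyOf := by
    intro l hl hk
    rcases keys_foldl_subset u [] (modeOf l) hk with h0 | h0
    · simp at h0
    · exact h l hl h0
  have := foldl_netAdd_append w (netTableFrom [] u) [] h'
  rw [List.append_nil] at this
  exact this

/-- **Net mode tables concatenate on mode-disjoint words.** -/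
theorem netModes_append (u w : Word) (h : ∀ l ∈ w, modeOf l ∉ u.map modeOf) :
    netModes (u ++ w) = netModes u ++ netModes w := by
  rw [netModes, netTable_append u w h, List.filter_append]; rfl

/-- **The coarse key is additive on mode-disjoint words** (the E2 bucketing identity). -/
theorem netKey_append (u w : Word) (h : ∀ l ∈ w, modeOf l ∉ u.map modeOf) :
    netKey (u ++ w) = netKey u + netKey w := by
  rw [netKey, netModes_append u w h, List.map_append, List.sum_append]; rfl

/-- The executable disjointness test the engine branches on. -/
def modeDisjoint (u w : Word) : Bool := w.all fun l => !(u.map modeOf).contains (modeOf l)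

/-- A passing test is the hypothesis of `netKey_append`. -/
theorem modeDisjoint_spec {u w : Word} (h : modeDisjoint u w = true) : ∀ l ∈ w, modeOf l ∉ u.map modeOf := by
  intro l hl hm
  rw [modeDisjoint, List.all_eq_true] at h
  have := h l hl
  rw [Bool.not_eq_true', ← Bool.not_eq_true, List.contains_iff_mem] at this
  exact this hm

/-- **Slot of a disjoint pair from the two precomputed keys.** -/
theorem netKey_append_mod (u w : Word) (J : ℕ) (h : modeDisjoint u w = true) :
    netKey (u ++ w) % J = (netKey u % J + netKey w % J) % J := by
  rw [netKey_append u w (modeDisjoint_spec h), Nat.add_mod]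

/-! ##### Kernel demos -/

private def la : Letter := ⟨![0, 0], 0, true⟩
private def lb : Letter := ⟨![1, 0], 1, false⟩
private def lc : Letter := ⟨![0, 1], 0, false⟩
private def ld : Letter := ⟨![0, 0], 0, false⟩

/-- Disjoint pair: keys add. -/
example : modeDisjoint [la, lb] [lc] = true ∧ netKey ([la, lb] ++ [lc]) = netKey [la, lb] + netKey [lc] := by decide +kernel

/-- Overlapping pair (`ld` annihilates `la`'s mode): the test fails and the keys do NOT add (net 0 mode dropped). -/
example : modeDisjoint [la, lb] [ld] = false ∧ netKey ([la, lb] ++ [ld]) ≠ netKey [la, lb] + netKey [ld] := by decide +kernel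

end Summit.Ventures.CertifiedManyBodySolver.Theorems.SymReplay.NetKeyAdd
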